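import Literature.Analysis.FluidPDE.CompressibleEulerProfileFieldAsymptotics
import Literature.Analysis.FluidPDE.CompressibleEulerExactSolutionDerivativeBounds
import HarnessLib

/-!
# The far field of the exact self-similar solution is regular up to the blow-up time
# (theorems only)

Topic `Literature/Analysis/FluidPDE`; namespace `Literature.Analysis.FluidPDE.CaolaboraEtAl2025`.
Sequel of `CompressibleEulerProfileFieldAsymptotics.lean` (eq. (1.6) of Cao-Labora–Gómez-Serrano–
Shi–Staffilani for the profile fields: `‖∇ⁿŪ(y)‖, ‖∇ⁿS̄(y)‖ ≤ C|y|^{1−r−n}` for `|y| ≥ R`) and of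
`CompressibleEulerExactSolutionDerivativeBounds.lean` (scaling of iterated derivatives).
THEOREMS ONLY, no new facts (D-0026).

The self-similar solution `u = r⁻¹(T−t)^{1/r−1}Ū(x(T−t)^{−1/r})`,
`σ = r⁻¹(T−t)^{1/r−1}S̄(x(T−t)^{−1/r})` is exactly critical for (1.6): the powers of `T − t`
cancel, `(1/r − 1) − n/r − (1−r−n)/r = 0`, so that OUTSIDE the shrinking region
`|x| < R (T−t)^{1/r}` every space derivative is bounded by a time-INDEPENDENT (and
`T`-independent) multiple of `|x|^{1−r−n}` (`exactSolution_farField_iteratedFDeriv_le`). This is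
the statement "`lim_{t→T} ρ(x,t)`, `lim_{t→T} u(x,t)` exist for all `x ≠ 0` and are smooth"
quoted for these solutions, in the quantitative form needed to truncate the exact solution away
from the core uniformly in the blow-up time (the data of the periodic problem in Rem. 1.5 of the
source). [cite: CaolaboraEtAl2025, eq. (1.6) p. 6, Thm 1.2 p. 6, Rem 1.5 p. 7; §1.3 p. 5]
-/

noncomputable section

open Set Filter Topology
open scoped ContDiff

namespace Literature.Analysis.FluidPDE

open Literature.MathematicalPhysics.KineticTheory (V3)

namespace CaolaboraEtAl2025

section FarField

variable {r T : ℝ} {U S : ℝ → ℝ} {Ub : V3 → V3} {Sb : V3 → ℝ} {u : ℝ → V3 → V3}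
  {σ : ℝ → V3 → ℝ}

/-- **Time-uniform far-field regularity of the exact self-similar solution.** For profiles as in
the vendored fact with `1 < r < 2` and every `n` there are `R > 0` and `C` such that for every
blow-up time `T`, every `t < T` and every `x` OUTSIDE the self-similar core,
`|x| ≥ R (T−t)^{1/r}`:
`‖∇ⁿu(t,·)(x)‖ ≤ C |x|^{1−r−n}` and `‖∇ⁿσ(t,·)(x)‖ ≤ C |x|^{1−r−n}` — independently of `t`
and `T` (the powers of `T − t` cancel exactly against eq. (1.6)).
[cite: CaolaboraEtAl2025, eq. (1.6) p. 6; §1.3 p. 5 (self-similar change of variables)] -/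
theorem exactSolution_farField_iteratedFDeriv_le (hr1 : 1 < r) (hr2 : r < 2)
    (hU : ContDiff ℝ ∞ fun y : V3 => (U ‖y‖ / ‖y‖) • y) (hS : ContDiff ℝ ∞ fun y : V3 => S ‖y‖)
    (hode : ∀ ζ : ℝ, 0 < ζ →
      (r - 1) * U ζ + (ζ + U ζ) * deriv U ζ + 1 / 3 * S ζ * deriv S ζ = 0 ∧
      (r - 1) * S ζ + (ζ + U ζ) * deriv S ζ + 1 / 3 * S ζ * (deriv U ζ + 2 * U ζ / ζ) = 0)
    (hlimU : Tendsto (fun ζ => U ζ / ζ) atTop (𝓝 0))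
    (hlimS : Tendsto (fun ζ => S ζ / ζ) atTop (𝓝 0))
    (hUb : Ub = fun y : V3 => (U ‖y‖ / ‖y‖) • y) (hSb : Sb = fun y : V3 => S ‖y‖)
    (hu : ∀ t x, u t x = (r⁻¹ * (T - t) ^ (1 / r - 1)) • Ub ((T - t) ^ (-1 / r) • x))
    (hσ : ∀ t x, σ t x = (r⁻¹ * (T - t) ^ (1 / r - 1)) * Sb ((T - t) ^ (-1 / r) • x)) (n : ℕ) :
    ∃ R C : ℝ, 0 < R ∧ ∀ t, t < T → ∀ x : V3, R * (T - t) ^ (1 / r) ≤ ‖x‖ →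
      ‖iteratedFDeriv ℝ n (u t) x‖ ≤ C * ‖x‖ ^ (1 - r - n) ∧
        ‖iteratedFDeriv ℝ n (σ t) x‖ ≤ C * ‖x‖ ^ (1 - r - n) := by
  obtain ⟨R₁, C₁, hR₁, hC₁⟩ := norm_iteratedFDeriv_radialField_sharp hr1 hr2 hU hS hode hlimU hlimS n
  obtain ⟨R₂, C₂, hR₂, hC₂⟩ := norm_iteratedFDeriv_radialScalar_sharp hr1 hr2 hU hS hode hlimU hlimS n
  have hr0 : 0 < r := by linarith
  have hUb' : ContDiff ℝ ∞ Ub := hUb ▸ hU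
  have hSb' : ContDiff ℝ ∞ Sb := hSb ▸ hS
  refine ⟨max R₁ R₂, r⁻¹ * max C₁ C₂, lt_max_of_lt_left hR₁, fun t ht x hx => ?_⟩
  -- the powers of `l = T - t`
  have hl : 0 < T - t := sub_pos.2 ht
  set a : ℝ := r⁻¹ * (T - t) ^ (1 / r - 1) with ha
  set e : ℝ := (T - t) ^ (-1 / r) with he
  have ha0 : 0 < a := mul_pos (inv_pos.2 hr0) (Real.rpow_pos_of_pos hl _)
  have he0 : 0 < e := Real.rpow_pos_of_pos hl _
  -- `e (T-t)^{1/r} = 1`, so `‖e • x‖ = e ‖x‖ ≥ max R₁ R₂`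
  have hel : e * (T - t) ^ (1 / r) = 1 := by
    rw [he, ← Real.rpow_add hl]
    rw [show (-1 / r + 1 / r : ℝ) = 0 by ring, Real.rpow_zero]
  have hRpos : 0 < max R₁ R₂ := lt_max_of_lt_left hR₁
  have hx0 : 0 < ‖x‖ := lt_of_lt_of_le (mul_pos hRpos (Real.rpow_pos_of_pos hl _)) hx
  have hex : ‖e • x‖ = e * ‖x‖ := by rw [norm_smul, Real.norm_eq_abs, abs_of_pos he0]
  have hexR : max R₁ R₂ ≤ ‖e • x‖ := by
    rw [hex]
    have h1 : e * (max R₁ R₂ * (T - t) ^ (1 / r)) ≤ e * ‖x‖ := mul_le_mul_of_nonneg_left hx he0.le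
    calc max R₁ R₂ = e * (max R₁ R₂ * (T - t) ^ (1 / r)) := by
          rw [show e * (max R₁ R₂ * (T - t) ^ (1 / r)) = max R₁ R₂ * (e * (T - t) ^ (1 / r)) by ring,
            hel, mul_one]
      _ ≤ e * ‖x‖ := h1
  -- the cancellation of the powers: `a eⁿ (e‖x‖)^{1-r-n} = r⁻¹ ‖x‖^{1-r-n}`
  have hcancel : a * e ^ n * (e * ‖x‖) ^ (1 - r - n) = r⁻¹ * ‖x‖ ^ (1 - r - n) := by
    rw [Real.mul_rpow he0.le hx0.le, ha, he]
    have h1 : ((T - t) ^ (-1 / r)) ^ n = (T - t) ^ (-1 / r * n) := by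
      rw [Real.rpow_mul hl.le, Real.rpow_natCast]
    have h2 : ((T - t) ^ (-1 / r)) ^ (1 - r - (n : ℝ)) = (T - t) ^ (-1 / r * (1 - r - n)) := by
      rw [Real.rpow_mul hl.le]
    rw [h1, h2]
    have h3 : (T - t) ^ (1 / r - 1) * (T - t) ^ (-1 / r * (n : ℝ)) *
        (T - t) ^ (-1 / r * (1 - r - n)) = 1 := by
      rw [← Real.rpow_add hl, ← Real.rpow_add hl]
      rw [show (1 / r - 1 + -1 / r * (n : ℝ) + -1 / r * (1 - r - n)) = 0 by field_simp; ring,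
        Real.rpow_zero]
    calc r⁻¹ * (T - t) ^ (1 / r - 1) * (T - t) ^ (-1 / r * ↑n) *
          ((T - t) ^ (-1 / r * (1 - r - ↑n)) * ‖x‖ ^ (1 - r - ↑n))
        = r⁻¹ * ((T - t) ^ (1 / r - 1) * (T - t) ^ (-1 / r * ↑n) *
            (T - t) ^ (-1 / r * (1 - r - ↑n))) * ‖x‖ ^ (1 - r - ↑n) := by ring
      _ = r⁻¹ * ‖x‖ ^ (1 - r - ↑n) := by rw [h3, mul_one]
  -- the generic estimate
  have key : ∀ {G : Type} [NormedAddCommGroup G] [NormedSpace ℝ G] {F : V3 → G} {CF : ℝ},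
      ContDiff ℝ ∞ F → ‖iteratedFDeriv ℝ n F (e • x)‖ ≤ CF * ‖e • x‖ ^ (1 - r - n) →
      CF ≤ max C₁ C₂ →
      ‖iteratedFDeriv ℝ n (fun x => a • F (e • x)) x‖ ≤ r⁻¹ * max C₁ C₂ * ‖x‖ ^ (1 - r - n) := by
    intro G _ _ F CF hF hB hCF
    have hFe : ContDiff ℝ ∞ fun x : V3 => F (e • x) := hF.comp (contDiff_const_smul e)
    rw [iteratedFDeriv_const_smul_apply' (hFe.contDiffAt.of_le (by exact_mod_cast le_top)), norm_smul,
      Real.norm_eq_abs, abs_of_pos ha0]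
    have hpow : 0 ≤ (e * ‖x‖) ^ (1 - r - n) := Real.rpow_nonneg (by positivity) _
    calc a * ‖iteratedFDeriv ℝ n (fun x => F (e • x)) x‖
        ≤ a * (e ^ n * ‖iteratedFDeriv ℝ n F (e • x)‖) :=
          mul_le_mul_of_nonneg_left (norm_iteratedFDeriv_comp_smul_le hF he0.le n x) ha0.le
      _ ≤ a * (e ^ n * (CF * ‖e • x‖ ^ (1 - r - n))) := by gcongr
      _ = CF * (a * e ^ n * (e * ‖x‖) ^ (1 - r - n)) := by rw [hex]; ring
      _ = CF * (r⁻¹ * ‖x‖ ^ (1 - r - n)) := by rw [hcancel]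
      _ ≤ max C₁ C₂ * (r⁻¹ * ‖x‖ ^ (1 - r - n)) :=
          mul_le_mul_of_nonneg_right hCF (by positivity)
      _ = r⁻¹ * max C₁ C₂ * ‖x‖ ^ (1 - r - n) := by ring
  constructor
  · have hfun : u t = fun x => a • Ub (e • x) := funext fun x => hu t x
    rw [hfun]
    refine key hUb' ?_ (le_max_left _ _)
    rw [hUb]
    exact hC₁ _ ((le_max_left _ _).trans hexR)
  · have hfun : σ t = fun x => a • Sb (e • x) := funext fun x => by rw [hσ t x, smul_eq_mul]
    rw [hfun]
    refine key hSb' ?_ (le_max_right _ _)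
    rw [hSb]
    exact hC₂ _ ((le_max_right _ _).trans hexR)

end FarField

end CaolaboraEtAl2025

end Literature.Analysis.FluidPDE
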